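import Mathlib
import HarnessLib
import Literature.MathematicalPhysics.QuantumLattice.HubbardUVSymbolCTDifferences

/-!
# K3 gen-8-FLOW (stmt 20437 `KLRegimeEngineV17F2`, stub (C), located risk «(C)-B-REP», item (γ-b) core): the band derivative of the TRUNCATED Matsubara
# density is small — `|Σ_i (ω_i² − e²)/(ω_i² + e²)²| ≤ β²/(2π²M) + 2π²/(β|e|³)` — by the MIDPOINT structure of the fermionic frequencies

Cell gate-hubbard-kl, seat p2 g12; pen ruling (R59c) (γ): the SIGNED ultraviolet-density response (design memo GAMMA-B-DESIGN-p2g12.md §3(c)).  Above the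
cutoff shell the frame-shift of the summed symbol `Σ_i Ψ((ω_i,k⃗),σ) = βL²·T(e_K(k⃗))`, `T(e) = Σ_i e/(ω_i² + e²)`, is governed by
`T′(e) = Σ_i (ω_i² − e²)/(ω_i² + e²)² = −Σ_i h′(ω_i)`, `h(ω) = ω/(ω² + e²)`.  Termwise `|T′| ≤ Σ_i 1/(ω_i²+e²) ≤ β/(2|e|)` — the bound that costs the `log` of memo
B-DOOR-LAW §2(b).  But the fermionic frequencies `ω_i = (n+½)·2π/β` are the MIDPOINTS of the cells `[n, n+1]·2π/β`, so `Σ_i h′(ω_i)·Δ` is a midpoint Riemann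
sum of the exact derivative `h′`: it telescopes to the boundary values `±h(MΔ)` up to per-cell defects, and for the rational `h` the defect is EXPLICIT:

* `midpoint_defect_eq` — `Δ·h′(m) − (h(m+d) − h(m−d)) = 2d³·(e⁴ − 6e²m² + m⁴ + d²(e² − m²)) / ((m²+e²)²·((m+d)²+e²)·((m−d)²+e²))`, `Δ = 2d`;
* `abs_midpoint_defect_le` — `≤ 8d³/((m² + e²)·e²)` for `d ≤ |m|`, `e ≠ 0`;
* **`abs_sum_matsubaraIdx_densityDeriv_le`** — `|Σ_i (ω_i² − e²)/(ω_i² + e²)²| ≤ β²/(2π²M) + 2π²/(β·|e|³)` (`0 < β`, `1 ≤ M`, `e ≠ 0`):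
  the first term is the truncation (`2|h(MΔ)|/Δ`), the second the summed defects (`(Δ²/e²)·Σ_i 1/(ω_i²+e²) ≤ (Δ²/e²)·β/(2|e|)`).
  Summed over the momenta with `|e_K| ≥ 2Λ` against the density of states this is `O(β·L²)` per unit frame shift on the extended ladder (`βΛ ≥ π/4`) — no `log`.

Pure real analysis of finite sums; no definitions; nothing about the model is asserted.  References: BGM 2006 §2.1 (2.2)–(2.5) [cite: BenfattoGiulianiMastropietro2006];
Giuliani–Mastropietro 2010 App. A (A.19)–(A.21) (truncated Matsubara sums).
-/

noncomputable section

namespace Summit.HubbardSuperconductivity.HubbardSuperconductivity.Theorems.EngineV8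

set_option linter.dupNamespace false -- summit = problem name (single-conjunct summit), D-0017

open Finset Real Literature.MathematicalPhysics.QuantumLattice

/-! ## §1 The midpoint defect of `h(ω) = ω/(ω² + e²)` on one cell, exactly -/

/-- **The midpoint defect, exact**: with `h(x) = x/(x² + e²)`, `h′(m) = (e² − m²)/(m² + e²)²`,
`2d·h′(m) − (h(m+d) − h(m−d)) = 2d³·(e⁴ − 6e²m² + m⁴ + d²(e² − m²)) / ((m²+e²)²·(((m+d)²+e²)·((m−d)²+e²)))` (`e ≠ 0`). -/
theorem midpoint_defect_eq (m d e : ℝ) (he : e ≠ 0) :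
    2 * d * ((e ^ 2 - m ^ 2) / (m ^ 2 + e ^ 2) ^ 2) - ((m + d) / ((m + d) ^ 2 + e ^ 2) - (m - d) / ((m - d) ^ 2 + e ^ 2)) =
      2 * d ^ 3 * (e ^ 4 - 6 * e ^ 2 * m ^ 2 + m ^ 4 + d ^ 2 * (e ^ 2 - m ^ 2)) /
        ((m ^ 2 + e ^ 2) ^ 2 * (((m + d) ^ 2 + e ^ 2) * ((m - d) ^ 2 + e ^ 2))) := by
  have he2 : 0 < e ^ 2 := by positivity
  have h1 : m ^ 2 + e ^ 2 ≠ 0 := by positivity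
  have h2 : (m + d) ^ 2 + e ^ 2 ≠ 0 := by positivity
  have h3 : (m - d) ^ 2 + e ^ 2 ≠ 0 := by positivity
  field_simp
  ring

/-- **The midpoint defect is `O(d³/((m²+e²)e²))`**: `|2d·h′(m) − (h(m+d) − h(m−d))| ≤ 8d³/((m² + e²)·e²)` for `0 ≤ d ≤ |m|`, `e ≠ 0`. -/
theorem abs_midpoint_defect_le (m d e : ℝ) (he : e ≠ 0) (hd : 0 ≤ d) (hdm : d ≤ |m|) :
    |2 * d * ((e ^ 2 - m ^ 2) / (m ^ 2 + e ^ 2) ^ 2) - ((m + d) / ((m + d) ^ 2 + e ^ 2) - (m - d) / ((m - d) ^ 2 + e ^ 2))| ≤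
      8 * d ^ 3 / ((m ^ 2 + e ^ 2) * e ^ 2) := by
  rw [midpoint_defect_eq m d e he]
  have he2 : 0 < e ^ 2 := by positivity
  set P : ℝ := m ^ 2 + e ^ 2 with hP
  have hP0 : 0 < P := by positivity
  have hQ1 : 0 < (m + d) ^ 2 + e ^ 2 := by positivity
  have hQ2 : 0 < (m - d) ^ 2 + e ^ 2 := by positivity
  have hd2 : d ^ 2 ≤ m ^ 2 := by
    have := abs_le_abs_of_nonneg hd hdm
    rw [abs_abs] at this
    calc d ^ 2 = |d| ^ 2 := (sq_abs d).symm
      _ ≤ |m| ^ 2 := pow_le_pow_left₀ (abs_nonneg d) this 2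
      _ = m ^ 2 := sq_abs m
  -- numerator
  have hnum : |e ^ 4 - 6 * e ^ 2 * m ^ 2 + m ^ 4 + d ^ 2 * (e ^ 2 - m ^ 2)| ≤ 4 * P ^ 2 := by
    rw [abs_le]
    constructor
    · nlinarith [sq_nonneg m, sq_nonneg e, mul_nonneg (sq_nonneg d) (sq_nonneg m), mul_nonneg (sq_nonneg d) he2.le]
    · nlinarith [sq_nonneg m, sq_nonneg e, mul_nonneg (sq_nonneg d) (sq_nonneg m), mul_nonneg (sq_nonneg d) he2.le]
  -- denominator: one factor dominates `P`, the other `e²`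
  have hden : P * e ^ 2 ≤ ((m + d) ^ 2 + e ^ 2) * ((m - d) ^ 2 + e ^ 2) := by
    rcases le_total 0 m with hm | hm
    · have h1 : P ≤ (m + d) ^ 2 + e ^ 2 := by rw [hP]; nlinarith
      have h2 : e ^ 2 ≤ (m - d) ^ 2 + e ^ 2 := by nlinarith [sq_nonneg (m - d)]
      exact mul_le_mul h1 h2 he2.le hQ1.le
    · have h1 : P ≤ (m - d) ^ 2 + e ^ 2 := by rw [hP]; nlinarith
      have h2 : e ^ 2 ≤ (m + d) ^ 2 + e ^ 2 := by nlinarith [sq_nonneg (m + d)]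
      calc P * e ^ 2 = e ^ 2 * P := mul_comm _ _
        _ ≤ ((m + d) ^ 2 + e ^ 2) * ((m - d) ^ 2 + e ^ 2) := mul_le_mul h2 h1 hP0.le hQ1.le
  rw [abs_div, abs_mul, abs_mul, abs_of_nonneg (by positivity : (0 : ℝ) ≤ 2), abs_of_nonneg (pow_nonneg hd 3),
    abs_of_pos (by positivity : (0 : ℝ) < P ^ 2 * (((m + d) ^ 2 + e ^ 2) * ((m - d) ^ 2 + e ^ 2)))]
  rw [div_le_div_iff₀ (by positivity) (by positivity)]
  calc 2 * d ^ 3 * |e ^ 4 - 6 * e ^ 2 * m ^ 2 + m ^ 4 + d ^ 2 * (e ^ 2 - m ^ 2)| * (P * e ^ 2)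
      ≤ 2 * d ^ 3 * (4 * P ^ 2) * (P * e ^ 2) := by gcongr
    _ = 8 * d ^ 3 * (P ^ 2 * (P * e ^ 2)) := by ring
    _ ≤ 8 * d ^ 3 * (P ^ 2 * (((m + d) ^ 2 + e ^ 2) * ((m - d) ^ 2 + e ^ 2))) := by gcongr

/-! ## §2 The telescoping sum over the fermionic frequencies -/

/-- The fermionic frequencies are bounded below in modulus by `π/β`: `π/β ≤ |ω_i|` (`0 < β`). -/
theorem pi_div_le_abs_matsubaraFreq {β : ℝ} (hβ : 0 < β) (M : ℕ) (i : MatsubaraIdx M) : π / β ≤ |matsubaraFreq β M i| := by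
  rw [matsubaraFreq, abs_div, abs_of_pos hβ, abs_mul, abs_of_pos Real.pi_pos, div_le_div_iff_of_pos_right hβ]
  have h : (1 : ℝ) ≤ |2 * (matsubaraInt M i : ℝ) + 1| := by
    have hz : (2 * (matsubaraInt M i : ℝ) + 1) = ((2 * matsubaraInt M i + 1 : ℤ) : ℝ) := by push_cast; ring
    rw [hz, ← Int.cast_abs, ← Int.cast_one, Int.cast_le]
    have : (2 * matsubaraInt M i + 1) ≠ 0 := by omega
    exact Int.one_le_abs this
  calc π = π * 1 := (mul_one π).symm
    _ ≤ π * |2 * (matsubaraInt M i : ℝ) + 1| := mul_le_mul_of_nonneg_left h Real.pi_pos.le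

/-- The cell endpoints around `ω_i`: `ω_i − π/β = (i − M)·(2π/β)` and `ω_i + π/β = (i − M + 1)·(2π/β)`. -/
theorem matsubaraFreq_sub_add_pi_div (β : ℝ) (M : ℕ) (i : MatsubaraIdx M) :
    matsubaraFreq β M i - π / β = (((i : ℕ) : ℝ) - M) * (2 * π / β) ∧
      matsubaraFreq β M i + π / β = (((i : ℕ) : ℝ) - M + 1) * (2 * π / β) := by
  simp only [matsubaraFreq, matsubaraInt]
  push_cast
  constructor <;> ring

/-- **THE BAND DERIVATIVE OF THE TRUNCATED MATSUBARA DENSITY IS SMALL**: for `0 < β`, `1 ≤ M`, `e ≠ 0`,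
`|Σ_i (ω_i² − e²)/(ω_i² + e²)²| ≤ β²/(2π²M) + 2π²/(β·|e|³)` — truncation + summed midpoint defects; no `β/|e|`, no log. -/
theorem abs_sum_matsubaraIdx_densityDeriv_le {β : ℝ} (hβ : 0 < β) {M : ℕ} (hM : 1 ≤ M) {e : ℝ} (he : e ≠ 0) :
    |∑ i : MatsubaraIdx M, (matsubaraFreq β M i ^ 2 - e ^ 2) / (matsubaraFreq β M i ^ 2 + e ^ 2) ^ 2| ≤
      β ^ 2 / (2 * π ^ 2 * M) + 2 * π ^ 2 / (β * |e| ^ 3) := by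
  have hπ := Real.pi_pos
  set Δ : ℝ := 2 * π / β with hΔ
  set d : ℝ := π / β with hd
  have hΔd : Δ = 2 * d := by rw [hΔ, hd]; ring
  have hd0 : 0 < d := by positivity
  have hΔ0 : 0 < Δ := by positivity
  have he2 : 0 < e ^ 2 := by positivity
  have hea : 0 < |e| := abs_pos.2 he
  -- the primitive along the cells
  set h : ℝ → ℝ := fun x => x / (x ^ 2 + e ^ 2) with hh
  set F : ℕ → ℝ := fun n => h (((n : ℝ) - M) * Δ) with hF
  -- per-cell: `Δ·g_i = −(F(i+1) − F(i)) − ρ_i`, `|ρ_i| ≤ Δ³/((ω_i²+e²)e²)`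
  have hcell : ∀ i : MatsubaraIdx M,
      |Δ * ((matsubaraFreq β M i ^ 2 - e ^ 2) / (matsubaraFreq β M i ^ 2 + e ^ 2) ^ 2) + (F ((i : ℕ) + 1) - F (i : ℕ))| ≤
        Δ ^ 3 / ((matsubaraFreq β M i ^ 2 + e ^ 2) * e ^ 2) := by
    intro i
    set m := matsubaraFreq β M i with hm
    obtain ⟨hlo, hhi⟩ := matsubaraFreq_sub_add_pi_div β M i
    have hF0 : F (i : ℕ) = h (m - d) := by
      simp only [hF]
      rw [hm, hd, hΔ, hlo]
    have hF1 : F ((i : ℕ) + 1) = h (m + d) := by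
      simp only [hF]
      rw [hm, hd, hΔ, hhi]
      congr 1
      push_cast
      ring
    have hdm : d ≤ |m| := by rw [hd, hm]; exact pi_div_le_abs_matsubaraFreq hβ M i
    have hdef := abs_midpoint_defect_le m d e he hd0.le hdm
    have hrew : Δ * ((m ^ 2 - e ^ 2) / (m ^ 2 + e ^ 2) ^ 2) + (F ((i : ℕ) + 1) - F (i : ℕ)) =
        -(2 * d * ((e ^ 2 - m ^ 2) / (m ^ 2 + e ^ 2) ^ 2) - ((m + d) / ((m + d) ^ 2 + e ^ 2) - (m - d) / ((m - d) ^ 2 + e ^ 2))) := by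
      rw [hF0, hF1, hh, hΔd]
      ring
    rw [hrew, abs_neg]
    refine hdef.trans (le_of_eq ?_)
    rw [hΔd]; ring
  -- sum the cells: the telescoping part
  have htele : ∑ i : MatsubaraIdx M, (F ((i : ℕ) + 1) - F (i : ℕ)) = F (2 * M) - F 0 := by
    rw [Fin.sum_univ_eq_sum_range (fun n => F (n + 1) - F n) (2 * M), Finset.sum_range_sub]
  have hF2M : F (2 * M) = h ((M : ℝ) * Δ) := by rw [hF]; push_cast; ring_nf
  have hF00 : F 0 = -h ((M : ℝ) * Δ) := by
    rw [hF, hh]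
    simp only [Nat.cast_zero, zero_sub]
    rw [show (-(M : ℝ) * Δ) = -((M : ℝ) * Δ) by ring, neg_sq]
    ring
  have hMΔ : 0 < (M : ℝ) * Δ := by
    have : (0 : ℝ) < M := by exact_mod_cast hM
    positivity
  have hhM : |h ((M : ℝ) * Δ)| ≤ 1 / ((M : ℝ) * Δ) := by
    rw [hh]
    simp only
    rw [abs_div, abs_of_pos hMΔ, abs_of_pos (by positivity : (0 : ℝ) < ((M : ℝ) * Δ) ^ 2 + e ^ 2),
      div_le_div_iff₀ (by positivity) hMΔ, one_mul]
    nlinarith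
  -- sum of the defects
  have hsumρ : ∑ i : MatsubaraIdx M, Δ ^ 3 / ((matsubaraFreq β M i ^ 2 + e ^ 2) * e ^ 2) ≤ Δ ^ 3 / e ^ 2 * (β / (2 * |e|)) := by
    have hs := sum_matsubaraIdx_inv_sq_add_sq_le hβ hea M
    have heq : ∀ i : MatsubaraIdx M, Δ ^ 3 / ((matsubaraFreq β M i ^ 2 + e ^ 2) * e ^ 2) =
        Δ ^ 3 / e ^ 2 * (1 / (matsubaraFreq β M i ^ 2 + |e| ^ 2)) := by
      intro i
      rw [sq_abs]
      field_simp
    simp_rw [heq]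
    rw [← mul_sum]
    exact mul_le_mul_of_nonneg_left hs (by positivity)
  -- the main estimate: `Δ·Σ g = −(F(2M) − F 0) − Σ ρ`
  set S := ∑ i : MatsubaraIdx M, (matsubaraFreq β M i ^ 2 - e ^ 2) / (matsubaraFreq β M i ^ 2 + e ^ 2) ^ 2 with hS
  have hkey : |Δ * S + (F (2 * M) - F 0)| ≤ Δ ^ 3 / e ^ 2 * (β / (2 * |e|)) := by
    have hexp : Δ * S + (F (2 * M) - F 0) =
        ∑ i : MatsubaraIdx M, (Δ * ((matsubaraFreq β M i ^ 2 - e ^ 2) / (matsubaraFreq β M i ^ 2 + e ^ 2) ^ 2) +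
          (F ((i : ℕ) + 1) - F (i : ℕ))) := by
      rw [sum_add_distrib, ← mul_sum, htele]
    rw [hexp]
    exact (abs_sum_le_sum_abs _ _).trans ((sum_le_sum fun i _ => hcell i).trans hsumρ)
  -- extract `|S|`
  have hΔS : |Δ * S| ≤ 2 * (1 / ((M : ℝ) * Δ)) + Δ ^ 3 / e ^ 2 * (β / (2 * |e|)) := by
    have h1 : |Δ * S| ≤ |Δ * S + (F (2 * M) - F 0)| + |F (2 * M) - F 0| := by
      have := abs_add_le (Δ * S + (F (2 * M) - F 0)) (-(F (2 * M) - F 0))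
      simp only [add_neg_cancel_right, abs_neg] at this
      exact this
    have h2 : |F (2 * M) - F 0| ≤ 2 * (1 / ((M : ℝ) * Δ)) := by
      rw [hF2M, hF00, sub_neg_eq_add, ← two_mul, abs_mul, abs_of_pos (by norm_num : (0 : ℝ) < 2)]
      exact mul_le_mul_of_nonneg_left hhM (by norm_num)
    linarith
  rw [abs_mul, abs_of_pos hΔ0] at hΔS
  rw [← mul_le_mul_iff_of_pos_left hΔ0]
  refine hΔS.trans (le_of_eq ?_)
  rw [hΔ]
  have hβ0 : β ≠ 0 := hβ.ne'
  have hM0 : (M : ℝ) ≠ 0 := by exact_mod_cast (by omega : M ≠ 0)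
  have hpi0 : π ≠ 0 := hπ.ne'
  have he3 : |e| ^ 3 = |e| * e ^ 2 := by rw [pow_succ, sq_abs]; ring
  rw [he3]
  field_simp

end Summit.HubbardSuperconductivity.HubbardSuperconductivity.Theorems.EngineV8

end
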